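import Mathlib
import Summits.PneNP.PneNP.Theorems.CnfIdealGenLengthRankDefectRepresentationsSimReduction
import Summits.PneNP.PneNP.Theorems.CnfIdealGenLengthRankDefectRepresentationsObliviousNoGo

/-!
# Crux `RankDefectRepresentations` (stmt-PneNP-18923), line `rank-dehn-ladder`, RESHAPE 17c: the registered stub
# `stub_defectShallow` — a pairwise SIM defect is within rank `O(n·t)` of a matrix on the Hamming-2 cells of its type

Setting (`…SimReduction`): rows `ι` and columns `ι'` carry cube colours `row x, col x' : Fin n → Bool`; `cut row col k M`
keeps the entries of `M` whose row and column colours differ at `k`; the PAIRWISE DEFECT of the SIM data `y` at `(k, l)` is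
`e_kl := cut k (cut l (y k − y l))`.

Contents.
* `rank_cut_defect_le` — the COCYCLE BOUND: `cut m e_kl = cut l (cut k (cut m (y k − y m))) + cut k (cut m (cut l (y m − y l)))`,
  so `rank (cut m e_kl) ≤ 2·rank e_km + 2·rank e_ml` (the skeleton's `rank_tripleCut_le`, re-proved here so that it is importable).
* `exists_hammingTwo_of_cuts` — the PUNCTURED CUT LEMMA (the content of the stub): for ANY matrix `R` (of any rank) whose
  coordinate cuts `cut j R`, `j ∉ {k, l}`, all have rank `≤ t`, the double cut `cut k (cut l R)` is within rank `16·n·t` of a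
  matrix supported on the Hamming-2 cells of type `{k, l}` (colours differ at `k` and at `l`, agree everywhere else).  Proof:
  the explicit cut lemma `…ObliviousNoGo.exists_nearDiagonal_of_cuts` (constant `4·n·t`) for the punctured colourings
  `σ ↦ (j ↦ if j = k ∨ j = l then false else σ j)`, then two more cuts (`rank_cut_le` twice).
* `stub_defectShallow` — the registered signature, verbatim: by the cocycle bound every cut of `e_kl` has rank `≤ 4t`, so the
  punctured cut lemma gives the Hamming-2 matrix `S` with `rank (e_kl − S) ≤ 16·n·4t = 64·n·t ≤ 64·(n+1)·t`.
  REMARK (for the lead): the registered signature is ALSO met by `S := 0`, because its hypothesis at `(i, j) = (k, l)` already says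
  `rank e_kl ≤ t ≤ 64(n+1)t`; the content-bearing statement is `exists_hammingTwo_of_cuts`, whose bound is in terms of the
  OTHER cuts only and applies to matrices of arbitrary rank.

HONEST FRAMING: elementary linear algebra (a TRUE calibration tool of the Σ-currency of RESHAPE 17); it does not touch the
item's deciding rung; P ≠ NP is not moved; F-N2 is a FRONTIER formal rung.
-/

set_option linter.dupNamespace false -- `Summit.PneNP.PneNP.…`: summit = sub-problem name (D-0017)

namespace Summit.PneNP.PneNP.Theorems.CnfIdealGenLengthRankDefectRepresentationsDefectShallow

open Summit.PneNP.PneNP.Theorems.CnfIdealGenLengthRankDefectRepresentationsSimReduction (cut cut_sub cut_comm rank_cut_le)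
open Summit.PneNP.PneNP.Theorems.CnfIdealGenLengthRankDefectRepresentationsMergeLowerBound (rank_add_le')
open Summit.PneNP.PneNP.Theorems.CnfIdealGenLengthRankDefectRepresentationsObliviousNoGo (exists_nearDiagonal_of_cuts)

variable {K : Type} [Field K]

section Tools

variable {ι ι' κ : Type} (row : ι → κ → Bool) (col : ι' → κ → Bool)

/-- Cuts are idempotent. -/
theorem cut_cut_self (k : κ) (M : Matrix ι ι' K) : cut row col k (cut row col k M) = cut row col k M := by
  ext x y; simp only [cut, Matrix.of_apply]; split_ifs <;> rfl

/-- Cuts are additive. -/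
theorem cut_add (k : κ) (M N : Matrix ι ι' K) : cut row col k (M + N) = cut row col k M + cut row col k N := by
  ext x y; simp only [cut, Matrix.of_apply, Matrix.add_apply]; split_ifs <;> simp

/-- A double cut is its own double cut: `cut k (cut l (cut k (cut l M))) = cut k (cut l M)`. -/
theorem cut_cut_cut_cut (k l : κ) (M : Matrix ι ι' K) :
    cut row col k (cut row col l (cut row col k (cut row col l M))) = cut row col k (cut row col l M) := by
  ext x y; simp only [cut, Matrix.of_apply]; split_ifs <;> rfl

variable [Fintype ι] [Fintype ι'] [DecidableEq ι] [DecidableEq ι']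

/-- **Cocycle bound.**  Every coordinate cut of a pairwise defect is controlled by the two adjacent defects:
`cut m (cut k (cut l (y k − y l))) = cut l (cut k (cut m (y k − y m))) + cut k (cut m (cut l (y m − y l)))` (split
`y k − y l = (y k − y m) + (y m − y l)`; cuts are additive and commute), hence, by `rank_cut_le`,
`rank (cut m (cut k (cut l (y k − y l)))) ≤ 2·rank (cut k (cut m (y k − y m))) + 2·rank (cut m (cut l (y m − y l)))`. -/
theorem rank_cut_defect_le (y : κ → Matrix ι ι' K) (k l m : κ) :
    (cut row col m (cut row col k (cut row col l (y k - y l)))).rank ≤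
      2 * (cut row col k (cut row col m (y k - y m))).rank + 2 * (cut row col m (cut row col l (y m - y l))).rank := by
  have hsplit : y k - y l = (y k - y m) + (y m - y l) := by abel
  have e : cut row col m (cut row col k (cut row col l (y k - y l))) =
      cut row col l (cut row col k (cut row col m (y k - y m))) +
        cut row col k (cut row col m (cut row col l (y m - y l))) := by
    rw [hsplit, cut_add, cut_add, cut_add]
    congr 1
    · rw [cut_comm row col k l, cut_comm row col m l, cut_comm row col m k]
    · rw [cut_comm row col m k]
  rw [e]
  refine (rank_add_le' _ _).trans ?_
  exact Nat.add_le_add (rank_cut_le row col l _) (rank_cut_le row col k _)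

end Tools

section HammingTwo

variable {ι ι' : Type} [Fintype ι] [Fintype ι'] [DecidableEq ι] [DecidableEq ι']

/-- **Punctured cut lemma** (the content of `stub_defectShallow`).  For ANY matrix `R` and coordinates `k, l`: if every
coordinate cut `cut j R` with `j ∉ {k, l}` has rank `≤ t`, then the double cut `cut k (cut l R)` is within rank `16·n·t` of a
matrix `S` supported on the Hamming-2 cells of type `{k, l}` — `S x x' = 0` whenever the colours of `x, x'` agree at `k`, or agree
at `l`, or differ at some other coordinate.  Proof: the explicit cut lemma `…ObliviousNoGo.exists_nearDiagonal_of_cuts` for the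
PUNCTURED colourings `σ ↦ (j ↦ if j = k ∨ j = l then false else σ j)` (their `k`- and `l`-cuts vanish, their other cuts are
those of `row, col`) gives `R'` supported on "all colours other than `k, l` agree" with `rank (R − R') ≤ 4·n·t`; put
`S := cut k (cut l R')`, so that `cut k (cut l R) − S = cut k (cut l (R − R'))`, and use `rank_cut_le` twice. [folklore] -/
theorem exists_hammingTwo_of_cuts {n : ℕ} (row : ι → Fin n → Bool) (col : ι' → Fin n → Bool) (t : ℕ) (k l : Fin n)
    (R : Matrix ι ι' K) (hcut : ∀ j : Fin n, j ≠ k → j ≠ l → (cut row col j R).rank ≤ t) :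
    ∃ S : Matrix ι ι' K,
      (∀ x x', (row x k = col x' k ∨ row x l = col x' l ∨ ∃ j, j ≠ k ∧ j ≠ l ∧ row x j ≠ col x' j) → S x x' = 0) ∧
      (cut row col k (cut row col l R) - S).rank ≤ 16 * (n * t) := by
  classical
  -- the punctured colourings: coordinates `k` and `l` are set to the constant `false`
  obtain ⟨row', hrow'⟩ : ∃ row' : ι → Fin n → Bool, row' = fun x j => if j = k ∨ j = l then false else row x j :=
    ⟨_, rfl⟩
  obtain ⟨col', hcol'⟩ : ∃ col' : ι' → Fin n → Bool, col' = fun x' j => if j = k ∨ j = l then false else col x' j :=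
    ⟨_, rfl⟩
  have hr : ∀ x j, row' x j = if j = k ∨ j = l then false else row x j := fun x j => by rw [hrow']
  have hc : ∀ x' j, col' x' j = if j = k ∨ j = l then false else col x' j := fun x' j => by rw [hcol']
  -- every coordinate cut of `R` for the punctured colourings has rank `≤ t`
  have hcut' : ∀ j : Fin n, (Matrix.of fun x x' => if row' x j ≠ col' x' j then R x x' else 0).rank ≤ t := by
    intro j
    by_cases hj : j = k ∨ j = l
    · have e : (Matrix.of fun x x' => if row' x j ≠ col' x' j then R x x' else 0) = 0 := by
        ext x x'
        simp only [Matrix.of_apply, Matrix.zero_apply, hr, hc, if_pos hj, ne_eq, not_true_eq_false, if_false]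
      rw [e, Matrix.rank_zero]
      exact Nat.zero_le _
    · have e : (Matrix.of fun x x' => if row' x j ≠ col' x' j then R x x' else 0) = cut row col j R := by
        ext x x'
        simp only [Matrix.of_apply, hr, hc, if_neg hj, cut]
      rw [e]
      exact hcut j (fun h => hj (Or.inl h)) (fun h => hj (Or.inr h))
  obtain ⟨R', hsupp, hrank⟩ := exists_nearDiagonal_of_cuts row' col' t R hcut'
  refine ⟨cut row col k (cut row col l R'), ?_, ?_⟩
  · rintro x x' (h | h | ⟨j, hjk, hjl, hj⟩)
    · simp [cut, h]
    · simp [cut, h]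
    · -- the punctured colours of `x` and `x'` differ (at `j`), so `R' x x' = 0`
      have hne : row' x ≠ col' x' := by
        intro hrc
        have hj' : ¬ (j = k ∨ j = l) := not_or.mpr ⟨hjk, hjl⟩
        have h1 := congr_fun hrc j
        rw [hr, hc, if_neg hj', if_neg hj'] at h1
        exact hj h1
      have hR' := hsupp x x' hne
      simp [cut, hR']
  · rw [← cut_sub, ← cut_sub]
    calc (cut row col k (cut row col l (R - R'))).rank
        ≤ 2 * (cut row col l (R - R')).rank := rank_cut_le row col k _
      _ ≤ 2 * (2 * (R - R').rank) := Nat.mul_le_mul_left 2 (rank_cut_le row col l _)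
      _ ≤ 2 * (2 * (4 * (n * t))) := Nat.mul_le_mul_left 2 (Nat.mul_le_mul_left 2 hrank)
      _ = 16 * (n * t) := by ring

end HammingTwo

/-- **PAIRWISE DEFECTS ARE SHALLOW** (registered stub `stub_defectShallow` of line `rank-dehn-ladder`, RESHAPE 17c, crux
stmt-PneNP-18923; brief g17 §W25).  For SIM data `y` with all pairwise defects of rank `≤ t`, the defect
`e_kl = cut k (cut l (y k − y l))` is within rank `64 (n+1) t` of a matrix `S` supported on the Hamming-2 cells of type `{k, l}`.
Proof: by the cocycle bound (`rank_cut_defect_le`) every coordinate cut of `e_kl` has rank `≤ 2t + 2t = 4t`, so the punctured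
cut lemma (`exists_hammingTwo_of_cuts`, with `R := e_kl`, which is its own double cut) gives `S` with
`rank (e_kl − S) ≤ 16·n·4t = 64·n·t ≤ 64·(n+1)·t`.
REMARK: the registered signature is also satisfied by `S := 0` (its hypothesis at `(i, j) = (k, l)` reads `rank e_kl ≤ t`);
the content-bearing form, for matrices of arbitrary rank and with the bound in terms of the OTHER cuts only, is
`exists_hammingTwo_of_cuts`. -/
theorem stub_defectShallow :
    ∀ (K : Type) [Field K] (n : ℕ) (ι ι' : Type) [Fintype ι] [Fintype ι'] [DecidableEq ι] [DecidableEq ι']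
      (row : ι → Fin n → Bool) (col : ι' → Fin n → Bool) (y : Fin n → Matrix ι ι' K) (t : ℕ) (k l : Fin n),
      (∀ i j, (Summit.PneNP.PneNP.Theorems.CnfIdealGenLengthRankDefectRepresentationsSimReduction.cut row col i (Summit.PneNP.PneNP.Theorems.CnfIdealGenLengthRankDefectRepresentationsSimReduction.cut row col j (y i - y j))).rank ≤ t) →
      ∃ S : Matrix ι ι' K,
        (∀ x x', (row x k = col x' k ∨ row x l = col x' l ∨ ∃ j, j ≠ k ∧ j ≠ l ∧ row x j ≠ col x' j) → S x x' = 0) ∧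
        (Summit.PneNP.PneNP.Theorems.CnfIdealGenLengthRankDefectRepresentationsSimReduction.cut row col k (Summit.PneNP.PneNP.Theorems.CnfIdealGenLengthRankDefectRepresentationsSimReduction.cut row col l (y k - y l)) - S).rank ≤ 64 * (n + 1) * t := by
  intro K _ n ι ι' _ _ _ _ row col y t k l hdef
  -- every coordinate cut of the defect `e_kl` has rank `≤ 4t` (cocycle bound + the pairwise hypothesis)
  have hcut : ∀ j : Fin n, j ≠ k → j ≠ l →
      (cut row col j (cut row col k (cut row col l (y k - y l)))).rank ≤ 4 * t := by
    intro j _ _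
    refine (rank_cut_defect_le row col y k l j).trans ?_
    have h1 := hdef k j
    have h2 := hdef j l
    omega
  obtain ⟨S, hS, hrank⟩ := exists_hammingTwo_of_cuts row col (4 * t) k l _ hcut
  refine ⟨S, hS, ?_⟩
  rw [cut_cut_cut_cut] at hrank
  refine hrank.trans ?_
  calc 16 * (n * (4 * t)) = 64 * (n * t) := by ring
    _ ≤ 64 * (n * t) + 64 * t := Nat.le_add_right _ _
    _ = 64 * (n + 1) * t := by ring

end Summit.PneNP.PneNP.Theorems.CnfIdealGenLengthRankDefectRepresentationsDefectShallow
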